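import Summits.AtomisticToContinuum.Crystallization.Theses.GappedShellCensus

/-!
# `GappedShellCensus.FiveFoldRationing` (stmt-AtomisticToContinuum-15931) from the repaired crux chain

`FiveFoldRationing` is the PRE-REPAIR rationing crux of route `GappedShellCensus` (re-kinded
support after the refutation of `ShellCensus`).  This file proves the bookkeeping that makes it a
COROLLARY of the three live cruxes of the repaired route,

  `ShellTrichotomy → TornFree → FiveFoldRationingR → FiveFoldRationing`,

without using the typing hypothesis of `FiveFoldRationing` at all:

* `ffr_shellFinset` — for a site `y` of an all-gapped-twelve configuration `Y` at scale `a > 0`,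
  the recentred, rescaled bond shell `T = a⁻¹ • (shell(y) − y)` is a `Finset` of twelve points with
  norms in `[0.98, 1.02]` and pairwise distances in `[0.98, 1.02] ∪ [1.26, ∞)` (the hypotheses of
  `ShellTrichotomy`), and the SHELL-DEGREE of a point `a⁻¹ • (v − y)` of `T` equals the number of
  COMMON bond partners of the bond `(y, v)` in `Y` (the quantity `TornFree` / `FiveFoldRationingR`
  speak about);
* `gappedCleanBalls_of_repairedChain` (typing-free form, the one the bridge
  `CleanLimitExtractionR` consumes) — in the five-ring-free balls delivered by
  `FiveFoldRationingR` every bond has exactly four common partners (`≤ 4` there, `≥ 4` by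
  `TornFree`), so branches (B) "capped" and (C) "torn" of the trichotomy are impossible and every
  shell in the ball is `1/5`-close to fcc or hcp;
* `fiveFoldRationing_of_repairedChain` — the route decl `FiveFoldRationing`, by dropping its typing
  hypothesis.
-/

noncomputable section

namespace Summit.AtomisticToContinuum.Crystallization.Theorems

open scoped Classical
open Literature.Geometry.DiscreteGeometry
open Summit.AtomisticToContinuum.Crystallization.Theses.GappedShellCensus

/-- Recentring at `y` and rescaling by `a⁻¹` scales distances by `a⁻¹`. -/
theorem ffr_dist_rescale {a : ℝ} (ha : 0 < a) (y v w : (EuclideanSpace ℝ (Fin 3))) :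
    dist (a⁻¹ • (v - y)) (a⁻¹ • (w - y)) = a⁻¹ * dist v w := by
  rw [dist_smul₀, norm_inv, Real.norm_of_nonneg ha.le, dist_sub_right]

/-- The norm of a recentred, rescaled point is the rescaled distance to the centre. -/
theorem ffr_norm_rescale {a : ℝ} (ha : 0 < a) (y w : (EuclideanSpace ℝ (Fin 3))) :
    ‖a⁻¹ • (w - y)‖ = a⁻¹ * dist y w := by
  rw [norm_smul, norm_inv, Real.norm_of_nonneg ha.le, ← dist_eq_norm, dist_comm]

/-- Recentring and rescaling is injective. -/
theorem ffr_rescale_injective {a : ℝ} (ha : 0 < a) (y : (EuclideanSpace ℝ (Fin 3))) :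
    Function.Injective fun w : (EuclideanSpace ℝ (Fin 3)) => a⁻¹ • (w - y) := by
  intro v w h
  have h' : v - y = w - y := smul_right_injective (EuclideanSpace ℝ (Fin 3)) (inv_ne_zero ha.ne') h
  exact sub_left_injective h'

/-- **Shell bookkeeping.**  In an all-gapped-twelve configuration `Y` at scale `a > 0`, the
recentred, rescaled bond shell of a site `y` is a `Finset` `T` of twelve points with norms in
`[1 - 1/50, 1 + 1/50]`, pairwise distances in `[1 - 1/50, 1 + 1/50] ∪ [63/50, ∞)`, and for every
point `v'` of `T`, `v' = a⁻¹ • (v - y)` for a bond partner `v` of `y` whose SHELL-DEGREE in `T`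
(number of other points of `T` within `1 + 1/50`) is the number of common bond partners of the
bond `(y, v)` in `Y`. -/
theorem ffr_shellFinset {Y : Set (EuclideanSpace ℝ (Fin 3))} {a : ℝ} (ha : 0 < a)
    (hgap : ∀ y ∈ Y, {w ∈ Y | w ≠ y ∧ dist y w ≤ a * (1 + 1 / 50)}.ncard = 12 ∧
      ∀ w ∈ Y, w ≠ y → a * (1 - 1 / 50) ≤ dist y w ∧
        (dist y w ≤ a * (1 + 1 / 50) ∨ a * (63 / 50) ≤ dist y w))
    {y : (EuclideanSpace ℝ (Fin 3))} (hy : y ∈ Y) :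
    ∃ T : Finset (EuclideanSpace ℝ (Fin 3)),
      (↑T : Set (EuclideanSpace ℝ (Fin 3))) = (fun w => a⁻¹ • (w - y)) '' {w ∈ Y | w ≠ y ∧ dist y w ≤ a * (1 + 1 / 50)} ∧
      T.card = 12 ∧
      (∀ v ∈ T, 1 - 1 / 50 ≤ ‖v‖ ∧ ‖v‖ ≤ 1 + 1 / 50) ∧
      (∀ v ∈ T, ∀ w ∈ T, v ≠ w → 1 - 1 / 50 ≤ dist v w ∧ (dist v w ≤ 1 + 1 / 50 ∨ 63 / 50 ≤ dist v w)) ∧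
      ∀ v' ∈ T, ∃ v ∈ Y, v ≠ y ∧ dist y v ≤ a * (1 + 1 / 50) ∧ v' = a⁻¹ • (v - y) ∧
        (T.filter fun w => w ≠ v' ∧ dist v' w ≤ 1 + 1 / 50).card =
          {w ∈ Y | w ≠ y ∧ w ≠ v ∧ dist y w ≤ a * (1 + 1 / 50) ∧ dist v w ≤ a * (1 + 1 / 50)}.ncard := by
  set S : Set (EuclideanSpace ℝ (Fin 3)) := {w ∈ Y | w ≠ y ∧ dist y w ≤ a * (1 + 1 / 50)} with hS_def
  set f : (EuclideanSpace ℝ (Fin 3)) → (EuclideanSpace ℝ (Fin 3)) := fun w => a⁻¹ • (w - y) with hf_def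
  have hfinj : Function.Injective f := ffr_rescale_injective ha y
  have hS12 : S.ncard = 12 := (hgap y hy).1
  have hSfin : S.Finite := Set.finite_of_ncard_pos (by rw [hS12]; norm_num)
  have hmemS : ∀ {w : (EuclideanSpace ℝ (Fin 3))}, w ∈ hSfin.toFinset ↔ w ∈ Y ∧ w ≠ y ∧ dist y w ≤ a * (1 + 1 / 50) :=
    fun {w} => by rw [Set.Finite.mem_toFinset]; rfl
  refine ⟨hSfin.toFinset.image f, ?_, ?_, ?_, ?_, ?_⟩
  · -- the coercion is the image of the shell
    rw [Finset.coe_image, Set.Finite.coe_toFinset]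
  · -- twelve points
    rw [Finset.card_image_of_injective _ hfinj, ← Set.ncard_eq_toFinset_card S hSfin, hS12]
  · -- norms in the bond window
    intro v' hv'
    obtain ⟨w, hw, rfl⟩ := Finset.mem_image.1 hv'
    obtain ⟨hwY, hwy, hwd⟩ := hmemS.1 hw
    have hlow := ((hgap y hy).2 w hwY hwy).1
    rw [show f w = a⁻¹ • (w - y) from rfl, ffr_norm_rescale ha]
    exact ⟨(le_inv_mul_iff₀ ha).2 hlow, (inv_mul_le_iff₀ ha).2 hwd⟩
  · -- pairwise distances: bond window or beyond the gap (radial condition at the partner `v`)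
    intro v' hv' w' hw' hne
    obtain ⟨v, hv, rfl⟩ := Finset.mem_image.1 hv'
    obtain ⟨w, hw, rfl⟩ := Finset.mem_image.1 hw'
    have hvY := (hmemS.1 hv).1
    have hwY := (hmemS.1 hw).1
    have hvw : w ≠ v := fun h => hne (by rw [h])
    obtain ⟨hlow, hdisj⟩ := (hgap v hvY).2 w hwY hvw
    rw [show f v = a⁻¹ • (v - y) from rfl, show f w = a⁻¹ • (w - y) from rfl, ffr_dist_rescale ha]
    refine ⟨(le_inv_mul_iff₀ ha).2 hlow, ?_⟩
    rcases hdisj with h | h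
    · exact Or.inl ((inv_mul_le_iff₀ ha).2 h)
    · exact Or.inr ((le_inv_mul_iff₀ ha).2 h)
  · -- shell-degree of `f v` in `T` = number of common bond partners of `(y, v)`
    intro v' hv'
    obtain ⟨v, hv, rfl⟩ := Finset.mem_image.1 hv'
    obtain ⟨hvY, hvy, hvd⟩ := hmemS.1 hv
    refine ⟨v, hvY, hvy, hvd, rfl, ?_⟩
    set C : Set (EuclideanSpace ℝ (Fin 3)) :=
      {w ∈ Y | w ≠ y ∧ w ≠ v ∧ dist y w ≤ a * (1 + 1 / 50) ∧ dist v w ≤ a * (1 + 1 / 50)} with hC_def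
    have hcoe : (↑((hSfin.toFinset.image f).filter fun w => w ≠ f v ∧ dist (f v) w ≤ 1 + 1 / 50) :
        Set (EuclideanSpace ℝ (Fin 3))) = f '' C := by
      rw [Finset.coe_filter]
      ext x
      simp only [Set.mem_setOf_eq, Finset.mem_image, Set.mem_image]
      constructor
      · rintro ⟨⟨w, hw, rfl⟩, hne, hdist⟩
        obtain ⟨hwY, hwy, hwd⟩ := hmemS.1 hw
        refine ⟨w, ⟨hwY, hwy, fun h => hne (by rw [h]), hwd, ?_⟩, rfl⟩
        rw [show f v = a⁻¹ • (v - y) from rfl, show f w = a⁻¹ • (w - y) from rfl,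
          ffr_dist_rescale ha] at hdist
        exact (inv_mul_le_iff₀ ha).1 hdist
      · rintro ⟨w, ⟨hwY, hwy, hwv, hwd, hvw⟩, rfl⟩
        refine ⟨⟨w, hmemS.2 ⟨hwY, hwy, hwd⟩, rfl⟩, fun h => hwv (hfinj h), ?_⟩
        rw [show f v = a⁻¹ • (v - y) from rfl, show f w = a⁻¹ • (w - y) from rfl,
          ffr_dist_rescale ha]
        exact (inv_mul_le_iff₀ ha).2 hvw
    rw [← Set.ncard_coe_finset, hcoe, Set.ncard_image_of_injective _ hfinj]

/-- **Clean balls from the repaired crux chain (typing-free form).**  If every gapped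
twelve-shell is fcc/hcp-close, capped or torn (`ShellTrichotomy`), no shell of an
all-gapped-twelve configuration is torn (`TornFree`), and torn-free all-gapped-twelve
configurations have five-ring-free balls of every radius (`FiveFoldRationingR`), then every
non-empty all-gapped-twelve configuration has, for every radius `R`, a ball `B(c, R)`, `c ∈ Y`, in
which every rescaled shell is `1/5`-close to the fcc or the hcp pattern: in a five-ring-free ball
every bond has exactly four common partners (`≤ 4` there, `≥ 4` by `TornFree`), so by
`ffr_shellFinset` all shell-degrees are four, which excludes branches (B) and (C) of the
trichotomy.  This is the form the bridge `CleanLimitExtractionR` consumes. -/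
theorem gappedCleanBalls_of_repairedChain (hS : ShellTrichotomy) (hT : TornFree)
    (hR : FiveFoldRationingR) (Y : Set (EuclideanSpace ℝ (Fin 3))) (a : ℝ) (ha : 0 < a) (hne : Y.Nonempty)
    (hgap : ∀ y ∈ Y, {w ∈ Y | w ≠ y ∧ dist y w ≤ a * (1 + 1 / 50)}.ncard = 12 ∧
      ∀ w ∈ Y, w ≠ y → a * (1 - 1 / 50) ≤ dist y w ∧
        (dist y w ≤ a * (1 + 1 / 50) ∨ a * (63 / 50) ≤ dist y w))
    (R : ℝ) :
    ∃ c ∈ Y, ∀ y ∈ Y, dist y c ≤ R → ∃ T : Finset (EuclideanSpace ℝ (Fin 3)),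
      (↑T : Set (EuclideanSpace ℝ (Fin 3))) = (fun w => a⁻¹ • (w - y)) '' {w ∈ Y | w ≠ y ∧ dist y w ≤ a * (1 + 1 / 50)} ∧
      (ShellCloseTo (1 / 5) T fccKissingPattern ∨ ShellCloseTo (1 / 5) T hcpKissingPattern) := by
  have htf := hT Y a ha hgap
  obtain ⟨c, hc, hcR⟩ := hR Y a ha hne hgap htf R
  refine ⟨c, hc, fun y hy hyc => ?_⟩
  obtain ⟨T, hTcoe, hTcard, hTnorm, hTdist, hTdeg⟩ := ffr_shellFinset ha hgap hy
  refine ⟨T, hTcoe, ?_⟩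
  rcases hS T hTcard hTnorm hTdist with h | h | ⟨v', hv', h5⟩ | ⟨v', hv', h3⟩
  · exact Or.inl h
  · exact Or.inr h
  · exfalso
    obtain ⟨v, hv, hvy, hvd, -, hdeg⟩ := hTdeg v' hv'
    have hle := hcR y hy hyc v hv hvy hvd
    rw [hdeg] at h5
    omega
  · exfalso
    obtain ⟨v, hv, hvy, hvd, -, hdeg⟩ := hTdeg v' hv'
    have hge := htf y hy v hv hvy hvd
    rw [hdeg] at h3
    omega

/-- **`FiveFoldRationing` is a corollary of the repaired crux chain**
`ShellTrichotomy → TornFree → FiveFoldRationingR`: its typing hypothesis (shells `1/5`-close to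
fcc, hcp or the decahedral-axis pattern) is simply dropped and
`gappedCleanBalls_of_repairedChain` applies. -/
theorem fiveFoldRationing_of_repairedChain (hS : ShellTrichotomy) (hT : TornFree)
    (hR : FiveFoldRationingR) : FiveFoldRationing :=
  fun Y a ha hne hyp R =>
    gappedCleanBalls_of_repairedChain hS hT hR Y a ha hne (fun y hy => (hyp y hy).1) R

end Summit.AtomisticToContinuum.Crystallization.Theorems

end
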